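import Literature.Analysis.FluidPDE.TaoCascadeOperator
import Mathlib.Analysis.Distribution.SchwartzSpace.Fourier
import Mathlib.Analysis.Fourier.LpSpace
import Mathlib.Analysis.Calculus.BumpFunction.InnerProduct
import Mathlib.Analysis.Normed.Group.Pointwise
import HarnessLib

/-!
# Tao's averaged Navier–Stokes blow-up: existence of the wavelet data of §4

T. Tao, *Finite time blowup for an averaged three-dimensional Navier–Stokes equation*,
J. Amer. Math. Soc. **29** (2016), 601–674 = arXiv:1402.0290v3 (held as `paper:arxiv-1402.0290`),
§4, p. 21: "Let `B_1, …, B_m` be balls in the annulus `{ξ ∈ ℝ³ : 1 < |ξ| ≤ 1 + ε₀/2}`, chosen so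
that the `2m` balls `B_1, …, B_m, -B_1, …, -B_m` are all disjoint. For each `i = 1, …, m`, let
`ψ_i ∈ H¹⁰_df(ℝ³)` be Schwartz with Fourier transform real-valued and supported on `B_i ∪ -B_i`,
normalised so that `‖ψ_i‖_{L²(ℝ³)} = 1`."

The accepted `Literature/Analysis/FluidPDE/TaoCascadeOperator.lean` records these data as the
hypothesis structure `CascadeWaveletData ε₀ m` and notes that "the existence of wavelet data (any
`m`, any `ε₀ > 0`) is routine but is **not** constructed" there. This file **constructs** them:

* `nonempty_cascadeWaveletData` — for every `ε₀ > 0` and every `m` there is a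
  `CascadeWaveletData ε₀ m` (so every statement taking the data as a hypothesis, e.g. the
  reduction of Theorem 3.3 to Lemma 4.1 and Theorem 4.2, is non-vacuous and can be fed).

The construction (standard; e.g. as in any Littlewood–Paley set-up): centres
`c_i = (1 + ε₀/4)(cos θ_i, sin θ_i, 0)`, `θ_i = (π/2)(i/m) ∈ [0, π/2)`, pairwise distinct and never
antipodal, a common radius `r < ε₀/4` smaller than half of every distance `|c_i ∓ c_j|`; and for a
ball `B = B(c, r)` the profile `ψ = Re 𝓕[G] / ‖Re 𝓕[G]‖₂` with the Fourier-side field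
`G(ξ) = (φ(ξ) + φ(-ξ)) (|ξ|² e₃ - ⟨e₃, ξ⟩ ξ)`, `φ` a smooth bump supported in `B`:
`G` is real, even, smooth, compactly supported in `B ∪ -B` and pointwise orthogonal to `ξ`, hence
(`exists_profile`) `𝓕[G]` is real (`fourier_im_eq_zero_of_even`), `𝓕(Re 𝓕[G]) = G` (Fourier
inversion on `𝓢`, `fourier_complexify_profileOf`), and `div Re 𝓕[G] = Re 𝓕[-2πi ⟨ξ, G⟩] = 0`
(`isDivFree_profileOf`, via Mathlib's `SchwartzMap.fderivCLM_fourier_eq`).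

## Mathlib / tree search

Mathlib (this pin) has the Fourier transform on Schwartz space with inversion
(`SchwartzMap.fourierTransformCLM`, `FourierInvPair`), its exchange with derivatives
(`SchwartzMap.fderivCLM_fourier_eq`), smooth bumps (`ContDiffBump`,
`HasCompactSupport.toSchwartzMap`) and the `L²`/`𝓢` comparison (`SchwartzMap.toLp_fourier_eq`);
it has no ready-made "Schwartz divergence-free field with prescribed Fourier support"
(`lean search` for `IsDivFree.*Schwartz`, `fourier_support`, `solenoidal`: nothing), and the tree's
`CascadeWaveletData` had only the empty instance `CascadeWaveletData.empty` (`m = 0`). The small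
glue lemmas on coordinates of vector-valued Fourier integrals (`fourier_apply_coord`,
`fourier_finset_sum`) are not in Mathlib in this form.

## References

* T. Tao, J. Amer. Math. Soc. 29 (2016), 601–674, arXiv:1402.0290v3, §4 p. 21. Key
  `Tao2016AveragedNS`.
-/

noncomputable section

open MeasureTheory Set Filter FourierTransform Metric
open scoped ENNReal NNReal SchwartzMap Topology RealInnerProductSpace Pointwise

namespace Literature.Analysis.FluidPDE.Tao2016

/-- Local notation for physical / frequency space `ℝ³`. -/
local notation "ℝ³" => EuclideanSpace ℝ (Fin 3)
/-- Local notation for the complexified range `ℂ³`. -/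
local notation "ℂ³" => EuclideanSpace ℂ (Fin 3)

/-! ### Construction of profiles: real and complex vector fields -/

/-- The complexification `ℝ³ → ℂ³` as a continuous linear map. [folklore] -/
abbrev complexifyL : ℝ³ →L[ℝ] ℂ³ :=
  FunctionSpaces.EuclideanSpace.complexify.toContinuousLinearMap

/-- The coordinatewise real part `ℂ³ → ℝ³` as a continuous (real-)linear map. [folklore] -/
def reVec : ℂ³ →L[ℝ] ℝ³ :=
  LinearMap.toContinuousLinearMap
    { toFun := fun v => WithLp.toLp 2 fun i => (v i).re
      map_add' := fun v w => by ext i; simp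
      map_smul' := fun r v => by ext i; simp }

/-- Coordinates of the real part: `(reVec v) i = Re (v i)`. [folklore] -/
@[simp]
theorem reVec_apply (v : ℂ³) (i : Fin 3) : reVec v i = (v i).re := rfl

/-- A real vector is the complexification of its real part. [folklore] -/
theorem complexify_reVec {v : ℂ³} (hv : ∀ i, (v i).im = 0) :
    FunctionSpaces.EuclideanSpace.complexify (reVec v) = v := by
  ext i
  apply Complex.ext <;> simp [hv]

/-- The complexification of a real Schwartz field, as a Schwartz map `ℝ³ → ℂ³`. [folklore] -/
def schwartzC (ψ : 𝓢(ℝ³, ℝ³)) : 𝓢(ℝ³, ℂ³) :=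
  SchwartzMap.postcompCLM (𝕜 := ℝ) complexifyL ψ

/-- The complexified Schwartz field is `complexify ∘ ψ` pointwise. [folklore] -/
@[simp]
theorem coe_schwartzC (ψ : 𝓢(ℝ³, ℝ³)) :
    ⇑(schwartzC ψ) = FunctionSpaces.EuclideanSpace.complexify ∘ ⇑ψ :=
  funext fun _ => rfl

/-- The `L²` class `schwartzL2 ψ` (accepted) is Mathlib's `SchwartzMap.toLp` of the complexified
field. [folklore] -/
theorem schwartzL2_eq_toLp (ψ : 𝓢(ℝ³, ℝ³)) : schwartzL2 ψ = (schwartzC ψ).toLp 2 :=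
  MemLp.toLp_congr _ _ (Eventually.of_forall fun _ => rfl)

/-- The real part of a complex Schwartz field, as a real Schwartz field. [folklore] -/
def schwartzRe (Ψ : 𝓢(ℝ³, ℂ³)) : 𝓢(ℝ³, ℝ³) :=
  SchwartzMap.postcompCLM (𝕜 := ℝ) reVec Ψ

/-- The real part of a complex Schwartz field, pointwise. [folklore] -/
@[simp]
theorem schwartzRe_apply (Ψ : 𝓢(ℝ³, ℂ³)) (x : ℝ³) : schwartzRe Ψ x = reVec (Ψ x) := rfl

/-! ### Fourier integrals of vector fields: coordinates, sums, realness -/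

/-- Coordinates commute with the Fourier integral. [folklore] -/
theorem fourier_apply_coord {F : ℝ³ → ℂ³} (hF : Integrable F) (x : ℝ³) (j : Fin 3) :
    𝓕 F x j = 𝓕 (fun v => F v j) x := by
  rw [Real.fourier_eq, Real.fourier_eq]
  have h := (EuclideanSpace.proj j : ℂ³ →L[ℂ] ℂ).integral_comp_comm
    ((Real.fourierIntegral_convergent_iff x).2 hF)
  simp only [PiLp.proj_apply] at h
  rw [← h]
  simp [Circle.smul_def]

/-- Coordinates commute with the inverse Fourier integral. [folklore] -/
theorem fourierInv_apply_coord {F : ℝ³ → ℂ³} (hF : Integrable F) (x : ℝ³) (j : Fin 3) :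
    𝓕⁻ F x j = 𝓕⁻ (fun v => F v j) x := by
  rw [Real.fourierInv_eq_fourier_neg, Real.fourierInv_eq_fourier_neg, fourier_apply_coord hF]

/-- Finite sums commute with the Fourier integral (integrable summands). [folklore] -/
theorem fourier_finset_sum {ι : Type*} (s : Finset ι) {F : ι → ℝ³ → ℂ} (hF : ∀ i ∈ s, Integrable (F i))
    (x : ℝ³) : 𝓕 (fun v => ∑ i ∈ s, F i v) x = ∑ i ∈ s, 𝓕 (F i) x := by
  simp only [Real.fourier_eq, Finset.smul_sum]
  rw [integral_finsetSum]
  exact fun i hi => (Real.fourierIntegral_convergent_iff x).2 (hF i hi)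

/-- **The Fourier transform of a real, even field is real.** [folklore] -/
theorem fourier_im_eq_zero_of_even {G : ℝ³ → ℂ³} (hG : Integrable G) (heven : ∀ v, G (-v) = G v)
    (hreal : ∀ v k, (G v k).im = 0) (x : ℝ³) (k : Fin 3) : (𝓕 G x k).im = 0 := by
  rw [← Complex.conj_eq_iff_im]
  have hGk : Integrable (fun v => G v k) :=
    (EuclideanSpace.proj k : ℂ³ →L[ℂ] ℂ).integrable_comp hG
  have h1 : 𝓕 G x k = ∫ v, (𝐞 (-⟪v, x⟫) : ℂ) * G v k := by
    rw [fourier_apply_coord hG, Real.fourier_eq]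
    simp [Circle.smul_def]
  have h2 : 𝓕⁻ G x k = ∫ v, (𝐞 ⟪v, x⟫ : ℂ) * G v k := by
    rw [fourierInv_apply_coord hG, Real.fourierInv_eq]
    simp [Circle.smul_def]
  have h3 : 𝓕⁻ G x = 𝓕 G x := by
    rw [Real.fourierInv_eq_fourier_comp_neg]
    simp_rw [heven]
  calc (starRingEnd ℂ) (𝓕 G x k) = (starRingEnd ℂ) (∫ v, (𝐞 (-⟪v, x⟫) : ℂ) * G v k) := by rw [h1]
    _ = ∫ v, (starRingEnd ℂ) ((𝐞 (-⟪v, x⟫) : ℂ) * G v k) := integral_conj.symm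
    _ = ∫ v, (𝐞 ⟪v, x⟫ : ℂ) * G v k := by
      congr 1
      funext v
      rw [map_mul, ← Circle.coe_inv_eq_conj, ← AddChar.map_neg_eq_inv, neg_neg,
        (Complex.conj_eq_iff_im).2 (hreal v k)]
    _ = 𝓕⁻ G x k := h2.symm
    _ = 𝓕 G x k := by rw [h3]

/-! ### Construction of profiles: the field `Re 𝓕[G]` -/

/-- The candidate profile built from a real Schwartz field `G` on the Fourier side: the real
part of the Fourier transform of (the complexification of) `G`. [folklore] -/
def profileOf (G : 𝓢(ℝ³, ℝ³)) : 𝓢(ℝ³, ℝ³) :=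
  schwartzRe (𝓕 (schwartzC G))

/-- `Re 𝓕[·]` is (real-)linear; in particular it commutes with scaling. [folklore] -/
theorem profileOf_smul (t : ℝ) (G : 𝓢(ℝ³, ℝ³)) : profileOf (t • G) = t • profileOf G := by
  simp only [profileOf, schwartzC, schwartzRe, map_smul, fourier_smul]

/-- For even `G`, `𝓕[G]` is real. [folklore] -/
theorem fourier_schwartzC_im {G : 𝓢(ℝ³, ℝ³)} (heven : ∀ v, G (-v) = G v) (x : ℝ³) (k : Fin 3) :
    ((𝓕 (schwartzC G)) x k).im = 0 := by
  rw [SchwartzMap.fourier_coe]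
  exact fourier_im_eq_zero_of_even (schwartzC G).integrable (fun v => by simp [heven])
    (fun v k => by simp) x k

/-- For even `G`, the complexification of `Re 𝓕[G]` is `𝓕[G]`. [folklore] -/
theorem complexify_profileOf {G : 𝓢(ℝ³, ℝ³)} (heven : ∀ v, G (-v) = G v) :
    FunctionSpaces.EuclideanSpace.complexify ∘ ⇑(profileOf G) = ⇑(𝓕 (schwartzC G) : 𝓢(ℝ³, ℂ³)) := by
  funext x
  simp only [Function.comp_apply, profileOf, schwartzRe_apply]
  exact complexify_reVec (fourier_schwartzC_im heven x)

/-- For even `G`, the complexification of `Re 𝓕[G]` is `𝓕[G]` (as Schwartz maps). [folklore] -/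
theorem schwartzC_profileOf {G : 𝓢(ℝ³, ℝ³)} (heven : ∀ v, G (-v) = G v) :
    schwartzC (profileOf G) = 𝓕 (schwartzC G) := by
  apply SchwartzMap.ext
  intro x
  exact congrFun (complexify_profileOf heven) x

/-- For even `G`, the Fourier transform of `Re 𝓕[G]` is `G` (Fourier inversion on `𝓢`). [folklore] -/
theorem fourier_complexify_profileOf {G : 𝓢(ℝ³, ℝ³)} (heven : ∀ v, G (-v) = G v) (ξ : ℝ³) :
    𝓕 (FunctionSpaces.EuclideanSpace.complexify ∘ ⇑(profileOf G)) ξ =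
      FunctionSpaces.EuclideanSpace.complexify (G ξ) := by
  rw [complexify_profileOf heven, ← SchwartzMap.fourier_coe]
  have h : 𝓕 (𝓕 (schwartzC G)) ξ = (𝓕⁻ (𝓕 (schwartzC G))) (-ξ) := by
    rw [SchwartzMap.fourierInv_coe, Real.fourierInv_eq_fourier_neg, neg_neg, SchwartzMap.fourier_coe]
  rw [h, fourierInv_fourier_eq]
  simp [heven]

/-- **`Re 𝓕[G]` is divergence free when `G(ξ) ⊥ ξ` for all `ξ`.** [folklore] -/
theorem isDivFree_profileOf {G : 𝓢(ℝ³, ℝ³)} (hG : ∀ v, ⟪v, G v⟫ = 0) :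
    VectorCalculus.IsDivFree ⇑(profileOf G) := by
  intro x
  set Ψ : 𝓢(ℝ³, ℂ³) := 𝓕 (schwartzC G) with hΨ
  set M : 𝓢(ℝ³, ℝ³ →L[ℝ] ℂ³) :=
    -(2 * Real.pi * Complex.I) • SchwartzMap.smulRightCLM ℂ ℂ³ (innerSL ℝ) (schwartzC G) with hM
  have hfd : fderiv ℝ (⇑(profileOf G)) x = reVec.comp (fderiv ℝ ⇑Ψ x) :=
    (reVec.hasFDerivAt.comp x (Ψ.hasFDerivAt x)).fderiv
  have hΨ' : ∀ m, fderiv ℝ ⇑Ψ x m = 𝓕 (⇑(SchwartzMap.evalCLM ℝ ℝ³ ℂ³ m M)) x := by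
    intro m
    have h := congrArg (fun T : 𝓢(ℝ³, ℝ³ →L[ℝ] ℂ³) => T x m)
      (SchwartzMap.fderivCLM_fourier_eq ℝ (schwartzC G))
    simp only [SchwartzMap.fderivCLM_apply] at h
    rw [h, ← hM, SchwartzMap.fourier_coe, Real.fourier_continuousLinearMap_apply M.integrable]
    rfl
  rw [divergence_eq_sum_inner_fderiv (EuclideanSpace.basisFun (Fin 3) ℝ), hfd]
  simp only [ContinuousLinearMap.coe_comp, Function.comp_apply, EuclideanSpace.basisFun_apply,
    EuclideanSpace.inner_single_left, map_one, one_mul, reVec_apply, hΨ']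
  rw [← Complex.re_sum]
  have key : ∑ k : Fin 3, 𝓕 (⇑(SchwartzMap.evalCLM ℝ ℝ³ ℂ³ (EuclideanSpace.single k (1 : ℝ)) M)) x k
      = 𝓕 (fun v => ∑ k : Fin 3,
          (SchwartzMap.evalCLM ℝ ℝ³ ℂ³ (EuclideanSpace.single k (1 : ℝ)) M) v k) x := by
    rw [fourier_finset_sum]
    · refine Finset.sum_congr rfl fun k _ => ?_
      rw [fourier_apply_coord
        ((SchwartzMap.evalCLM ℝ ℝ³ ℂ³ (EuclideanSpace.single k (1 : ℝ)) M).integrable)]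
    · intro k _
      exact (EuclideanSpace.proj k : ℂ³ →L[ℂ] ℂ).integrable_comp
        ((SchwartzMap.evalCLM ℝ ℝ³ ℂ³ (EuclideanSpace.single k (1 : ℝ)) M).integrable)
  have hzero : (fun v => ∑ k : Fin 3,
      (SchwartzMap.evalCLM ℝ ℝ³ ℂ³ (EuclideanSpace.single k (1 : ℝ)) M) v k) = fun _ => 0 := by
    funext v
    simp only [SchwartzMap.evalCLM_apply_apply, hM, smul_apply,
      SchwartzMap.smulRightCLM_apply_apply,
      ContinuousLinearMap.smulRight_apply, innerSL_apply_apply ℝ, EuclideanSpace.inner_single_right,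
      one_mul, coe_schwartzC, Function.comp_apply, PiLp.smul_apply, smul_eq_mul,
      FunctionSpaces.EuclideanSpace.complexify_apply, Complex.real_smul, conj_trivial]
    rw [← Finset.mul_sum]
    have : ∑ k : Fin 3, ((v k : ℝ) : ℂ) * ((G v k : ℝ) : ℂ) = ((⟪v, G v⟫ : ℝ) : ℂ) := by
      simp [PiLp.inner_apply, mul_comm]
    rw [this, hG v]
    simp
  rw [key, hzero]
  simp [Real.fourier_eq]

/-! ### Construction of profiles: a bump field on the Fourier side -/

/-- A smooth bump supported in the ball `B(c, ρ)`, equal to `1` on `B(c, ρ/2)`. [folklore] -/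
def bump (c : ℝ³) {ρ : ℝ} (hρ : 0 < ρ) : ContDiffBump c :=
  ⟨ρ / 2, ρ, half_pos hρ, half_lt_self hρ⟩

/-- The Fourier-side field `G(ξ) = (φ(ξ) + φ(-ξ)) (|ξ|² a - ⟨a, ξ⟩ ξ)` attached to the ball
`B(c, ρ)` and the direction `a`: real, even, smooth, supported in `B(c,ρ) ∪ -B(c,ρ)`, and
everywhere orthogonal to `ξ`. [folklore] -/
def bumpField (c a : ℝ³) {ρ : ℝ} (hρ : 0 < ρ) (ξ : ℝ³) : ℝ³ :=
  (bump c hρ ξ + bump c hρ (-ξ)) • (‖ξ‖ ^ 2 • a - ⟪a, ξ⟫ • ξ)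

/-- The bump field is smooth. [folklore] -/
theorem contDiff_bumpField (c a : ℝ³) {ρ : ℝ} (hρ : 0 < ρ) :
    ContDiff ℝ ((⊤ : ℕ∞) : WithTop ℕ∞) (bumpField c a hρ) := by
  have A : ContDiff ℝ ((⊤ : ℕ∞) : WithTop ℕ∞) (fun ξ : ℝ³ => bump c hρ ξ + bump c hρ (-ξ)) :=
    (bump c hρ).contDiff.add ((bump c hρ).contDiff.comp contDiff_neg)
  have B : ContDiff ℝ ((⊤ : ℕ∞) : WithTop ℕ∞) (fun ξ : ℝ³ => ‖ξ‖ ^ 2 • a - ⟪a, ξ⟫ • ξ) :=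
    ((contDiff_norm_sq ℝ).smul contDiff_const).sub
      ((contDiff_const.inner ℝ contDiff_id).smul contDiff_id)
  exact A.smul B

/-- The bump field vanishes at `ξ` whenever `ξ ∉ B(c,ρ)` and `-ξ ∉ B(c,ρ)`. [folklore] -/
theorem bumpField_eq_zero {c a : ℝ³} {ρ : ℝ} (hρ : 0 < ρ) {ξ : ℝ³} (h₁ : ξ ∉ ball c ρ)
    (h₂ : -ξ ∉ ball c ρ) : bumpField c a hρ ξ = 0 := by
  rw [mem_ball, not_lt] at h₁ h₂
  simp [bumpField, (bump c hρ).zero_of_le_dist h₁, (bump c hρ).zero_of_le_dist h₂]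

/-- The bump field has compact support (inside `B̄(c,ρ) ∪ B̄(-c,ρ)`). [folklore] -/
theorem hasCompactSupport_bumpField (c a : ℝ³) {ρ : ℝ} (hρ : 0 < ρ) :
    HasCompactSupport (bumpField c a hρ) := by
  refine HasCompactSupport.intro ((isCompact_closedBall c ρ).union (isCompact_closedBall (-c) ρ))
    fun ξ hξ => bumpField_eq_zero hρ (fun h => hξ (Or.inl (ball_subset_closedBall h))) fun h => ?_
  refine hξ (Or.inr (ball_subset_closedBall ?_))
  rw [mem_ball, dist_eq_norm] at h ⊢
  rwa [sub_neg_eq_add, ← norm_neg, neg_add, ← sub_eq_add_neg]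

/-- The bump field is even. [folklore] -/
theorem bumpField_neg (c a : ℝ³) {ρ : ℝ} (hρ : 0 < ρ) (ξ : ℝ³) :
    bumpField c a hρ (-ξ) = bumpField c a hρ ξ := by
  simp only [bumpField, neg_neg, norm_neg, inner_neg_right, neg_smul, smul_neg, neg_neg, add_comm]

/-- The bump field is pointwise orthogonal to the frequency: `⟨ξ, G(ξ)⟩ = 0`. [folklore] -/
theorem inner_bumpField (c a : ℝ³) {ρ : ℝ} (hρ : 0 < ρ) (ξ : ℝ³) : ⟪ξ, bumpField c a hρ ξ⟫ = 0 := by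
  simp only [bumpField, inner_smul_right, inner_sub_right, real_inner_self_eq_norm_sq,
    real_inner_comm a ξ]
  ring

/-- The value of the bump field at the centre `c` (`a ⊥ c`): `(1 + φ(-c)) |c|² a`. [folklore] -/
theorem bumpField_center {c a : ℝ³} {ρ : ℝ} (hρ : 0 < ρ) (hac : ⟪a, c⟫ = 0) :
    bumpField c a hρ c = ((1 + bump c hρ (-c)) * ‖c‖ ^ 2) • a := by
  have h1 : bump c hρ c = 1 := (bump c hρ).one_of_mem_closedBall (mem_closedBall_self (by
    change 0 ≤ ρ / 2; positivity))
  simp only [bumpField, h1, hac, zero_smul, sub_zero, smul_smul]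

/-- The bump field does not vanish at the centre (`c ≠ 0`, `a ≠ 0`, `a ⊥ c`). [folklore] -/
theorem bumpField_center_ne_zero {c a : ℝ³} {ρ : ℝ} (hρ : 0 < ρ) (hc : c ≠ 0) (ha : a ≠ 0)
    (hac : ⟪a, c⟫ = 0) : bumpField c a hρ c ≠ 0 := by
  rw [bumpField_center hρ hac, smul_ne_zero_iff]
  refine ⟨(mul_pos ?_ (by positivity)).ne', ha⟩
  linarith [(bump c hρ).nonneg' (-c)]

/-- The bump field as a Schwartz map. [folklore] -/
def bumpSchwartz (c a : ℝ³) {ρ : ℝ} (hρ : 0 < ρ) : 𝓢(ℝ³, ℝ³) :=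
  (hasCompactSupport_bumpField c a hρ).toSchwartzMap (contDiff_bumpField c a hρ)

/-- The bump Schwartz map is the bump field pointwise. [folklore] -/
@[simp]
theorem bumpSchwartz_apply (c a : ℝ³) {ρ : ℝ} (hρ : 0 < ρ) (ξ : ℝ³) :
    bumpSchwartz c a hρ ξ = bumpField c a hρ ξ := rfl

/-- Scaling a real Schwartz field scales its `L²` class. [folklore] -/
theorem schwartzL2_smul (t : ℝ) (ψ : 𝓢(ℝ³, ℝ³)) : schwartzL2 (t • ψ) = (t : ℂ) • schwartzL2 ψ := by
  rw [schwartzL2_eq_toLp, schwartzL2_eq_toLp, schwartzC, map_smul, Complex.coe_smul,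
    ← SchwartzMap.toLpCLM_apply (𝕜 := ℝ), map_smul, SchwartzMap.toLpCLM_apply]
  rfl

/-- **A single profile**: for a ball `B = B(c, ρ)` with `c ≠ 0` and a direction `a ≠ 0`,
`a ⊥ c`, there is a real Schwartz divergence-free field `ψ` with `ψ̂` real-valued, vanishing at
every `ξ` with `ξ ∉ B` and `-ξ ∉ B`, and `‖ψ‖_{L²} = 1`: normalise `Re 𝓕[G]` for the bump field
`G` of `B` and `a` (it is not zero since `Ĝ(c) = ψ̂(c) ≠ 0`). [folklore] -/
theorem exists_profile {c a : ℝ³} (hc : c ≠ 0) (ha : a ≠ 0) (hac : ⟪a, c⟫ = 0) {ρ : ℝ}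
    (hρ : 0 < ρ) :
    ∃ ψ : 𝓢(ℝ³, ℝ³), VectorCalculus.IsDivFree ⇑ψ ∧
      (∀ ξ k, (𝓕 (FunctionSpaces.EuclideanSpace.complexify ∘ ⇑ψ) ξ k).im = 0) ∧
      (∀ ξ, ξ ∉ ball c ρ → -ξ ∉ ball c ρ →
        𝓕 (FunctionSpaces.EuclideanSpace.complexify ∘ ⇑ψ) ξ = 0) ∧
      ‖schwartzL2 ψ‖ = 1 := by
  set G₀ := bumpSchwartz c a hρ with hG₀
  have heven : ∀ t : ℝ, ∀ v, (t • G₀) (-v) = (t • G₀) v := fun t v => by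
    simp [hG₀, bumpField_neg]
  have hperp : ∀ t : ℝ, ∀ v, ⟪v, (t • G₀) v⟫ = 0 := fun t v => by
    simp [hG₀, inner_smul_right, inner_bumpField]
  -- the unnormalised profile is not zero
  have hne : schwartzL2 (profileOf G₀) ≠ 0 := by
    intro h0
    have heven1 : ∀ v, G₀ (-v) = G₀ v := by simpa using heven 1
    have h1 : schwartzC (profileOf G₀) = 0 := by
      apply SchwartzMap.injective_toLp (E := ℝ³) (F := ℂ³) 2
      change (schwartzC (profileOf G₀)).toLp 2 = (0 : 𝓢(ℝ³, ℂ³)).toLp 2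
      rw [← schwartzL2_eq_toLp, h0, ← SchwartzMap.toLpCLM_apply (𝕜 := ℝ), map_zero]
    have h2 : 𝓕 (FunctionSpaces.EuclideanSpace.complexify ∘ ⇑(profileOf G₀)) c = 0 := by
      rw [← coe_schwartzC, h1]
      simp [Real.fourier_eq]
    rw [fourier_complexify_profileOf heven1] at h2
    exact bumpField_center_ne_zero hρ hc ha hac
      (FunctionSpaces.EuclideanSpace.complexify_injective (by simpa [hG₀] using h2))
  set t : ℝ := ‖schwartzL2 (profileOf G₀)‖⁻¹ with ht
  have htpos : 0 < t := inv_pos.2 (norm_pos_iff.2 hne)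
  refine ⟨profileOf (t • G₀), isDivFree_profileOf (hperp t), fun ξ k => ?_, fun ξ h₁ h₂ => ?_, ?_⟩
  · rw [fourier_complexify_profileOf (heven t)]
    simp
  · rw [fourier_complexify_profileOf (heven t)]
    simp [hG₀, bumpField_eq_zero hρ h₁ h₂]
  · rw [profileOf_smul, schwartzL2_smul, norm_smul, Complex.norm_real, Real.norm_of_nonneg htpos.le,
      ht, inv_mul_cancel₀ (norm_ne_zero_iff.2 hne)]

/-! ### Construction of profiles: centres, radii, and the family of §4 -/

/-- The unit vector `(cos θ, sin θ, 0)`. [folklore] -/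
def dirVec (θ : ℝ) : ℝ³ := !₂[Real.cos θ, Real.sin θ, 0]

/-- The third basis vector `(0, 0, 1)`. [folklore] -/
def e3 : ℝ³ := !₂[0, 0, 1]

/-- `(cos θ, sin θ, 0)` is a unit vector. [folklore] -/
theorem norm_dirVec (θ : ℝ) : ‖dirVec θ‖ = 1 := by
  rw [EuclideanSpace.norm_eq, Fin.sum_univ_three]
  simp [dirVec, Real.cos_sq_add_sin_sq]

/-- `(cos θ, sin θ, 0) ⊥ e₃`. [folklore] -/
theorem inner_e3_dirVec (θ : ℝ) : ⟪e3, dirVec θ⟫ = 0 := by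
  simp [e3, dirVec, PiLp.inner_apply, Fin.sum_univ_three]

/-- `e₃ ≠ 0`. [folklore] -/
theorem e3_ne_zero : e3 ≠ 0 := by
  intro h
  have := congrArg (fun v : ℝ³ => v 2) h
  simp [e3] at this

/-- The first coordinate of `(cos θ, sin θ, 0)`. [folklore] -/
theorem dirVec_apply_zero (θ : ℝ) : dirVec θ 0 = Real.cos θ := by simp [dirVec]

/-- **Existence of Tao's wavelet data of §4** (2016, p. 21: "Let `B_1, …, B_m` be balls in the
annulus `{1 < |ξ| ≤ 1 + ε₀/2}`, chosen so that the `2m` balls `B_1, …, B_m, -B_1, …, -B_m` are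
all disjoint. For each `i`, let `ψ_i ∈ H¹⁰_df(ℝ³)` be Schwartz with Fourier transform real-valued
and supported on `B_i ∪ -B_i`, normalised so that `‖ψ_i‖_{L²} = 1`"): such data — the accepted
hypothesis structure `CascadeWaveletData ε₀ m` — exist for every `ε₀ > 0` and every `m`. Centres
`(1 + ε₀/4)(cos θ_i, sin θ_i, 0)`, `θ_i = (π/2)(i/m)`, a common small radius, and the profiles of
`exists_profile`. [cite: Tao2016AveragedNS, §4 p. 21] -/
theorem nonempty_cascadeWaveletData {ε₀ : ℝ} (hε : 0 < ε₀) (m : ℕ) :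
    Nonempty (CascadeWaveletData ε₀ m) := by
  set ρ₀ : ℝ := 1 + ε₀ / 4 with hρ₀
  have hρ₀pos : 0 < ρ₀ := by positivity
  set θ : Fin m → ℝ := fun i => Real.pi / 2 * ((i : ℝ) / m) with hθ
  have hθrange : ∀ i, 0 ≤ θ i ∧ θ i < Real.pi / 2 := by
    intro i
    have hm : (0 : ℝ) < m := by exact_mod_cast Fin.pos i
    have hi : ((i : ℕ) : ℝ) < m := by exact_mod_cast i.isLt
    refine ⟨by positivity, ?_⟩
    calc Real.pi / 2 * ((i : ℝ) / m) < Real.pi / 2 * 1 := by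
          gcongr
          rwa [div_lt_one hm]
      _ = Real.pi / 2 := mul_one _
  set ξc : Fin m → ℝ³ := fun i => ρ₀ • dirVec (θ i) with hξc
  have hnorm : ∀ i, ‖ξc i‖ = ρ₀ := fun i => by
    rw [hξc, norm_smul, norm_dirVec, mul_one, Real.norm_of_nonneg hρ₀pos.le]
  have hξc_ne : ∀ i, ξc i ≠ 0 := fun i => by
    rw [← norm_ne_zero_iff, hnorm]
    exact hρ₀pos.ne'
  have hinner : ∀ i, ⟪e3, ξc i⟫ = 0 := fun i => by
    rw [hξc, inner_smul_right, inner_e3_dirVec, mul_zero]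
  -- distinct, non-antipodal centres
  have hne1 : ∀ i j, i ≠ j → ξc i ≠ ξc j := by
    intro i j hij h
    apply hij
    have h' : dirVec (θ i) = dirVec (θ j) := smul_right_injective ℝ³ hρ₀pos.ne' h
    have hcos : Real.cos (θ i) = Real.cos (θ j) := by
      rw [← dirVec_apply_zero, ← dirVec_apply_zero, h']
    have hθij : θ i = θ j := Real.injOn_cos ⟨(hθrange i).1, by linarith [(hθrange i).2, Real.pi_pos]⟩
      ⟨(hθrange j).1, by linarith [(hθrange j).2, Real.pi_pos]⟩ hcos
    have hm : (0 : ℝ) < m := by exact_mod_cast Fin.pos i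
    have : ((i : ℕ) : ℝ) = (j : ℕ) := by
      have h2 := mul_left_cancel₀ (by positivity : Real.pi / 2 ≠ 0) hθij
      field_simp at h2
      exact h2
    exact Fin.ext (by exact_mod_cast this)
  have hne2 : ∀ i j, ξc i ≠ -ξc j := by
    intro i j h
    have h0 := congrArg (fun v : ℝ³ => v 0) h
    simp only [hξc, PiLp.smul_apply, PiLp.neg_apply, smul_eq_mul, dirVec_apply_zero] at h0
    have hci : 0 < Real.cos (θ i) := Real.cos_pos_of_mem_Ioo ⟨by linarith [(hθrange i).1, Real.pi_pos],
      (hθrange i).2⟩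
    have hcj : 0 < Real.cos (θ j) := Real.cos_pos_of_mem_Ioo ⟨by linarith [(hθrange j).1, Real.pi_pos],
      (hθrange j).2⟩
    nlinarith
  -- a common small radius
  have hsmall : ∀ d : ℝ, 0 < d → ∀ᶠ r in 𝓝[>] (0 : ℝ), r + r < d := fun d hd =>
    ((eventually_lt_nhds (half_pos hd)).filter_mono nhdsWithin_le_nhds).mono fun r hr => by linarith
  have hev : ∀ᶠ r in 𝓝[>] (0 : ℝ), 0 < r ∧ r < ε₀ / 4 ∧
      (∀ i j, i ≠ j → r + r < dist (ξc i) (ξc j)) ∧ (∀ i j, r + r < dist (ξc i) (-ξc j)) := by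
    refine (eventually_mem_nhdsWithin).and ((((eventually_lt_nhds (by positivity : (0 : ℝ) < ε₀ / 4))).filter_mono
      nhdsWithin_le_nhds).and ((eventually_all.2 fun i => eventually_all.2 fun j => ?_).and
        (eventually_all.2 fun i => eventually_all.2 fun j => hsmall _ (dist_pos.2 (hne2 i j)))))
    by_cases hij : i = j
    · exact Eventually.of_forall fun r h => absurd hij h
    · exact (hsmall _ (dist_pos.2 (hne1 i j hij))).mono fun r hr _ => hr
  obtain ⟨r, hr0, hr1, hr2, hr3⟩ := hev.exists
  -- the profiles
  choose ψ hψ using fun i => exists_profile (hξc_ne i) e3_ne_zero (hinner i) hr0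
  refine ⟨{ center := ξc
            radius := fun _ => r
            ψ := ψ
            ball_subset := fun i ξ hξ => ?_
            disjoint := fun i j hij => ball_disjoint_ball (hr2 i j hij).le
            disjoint_neg := fun i j => ?_
            isDivFree := fun i => (hψ i).1
            fourier_im := fun i => (hψ i).2.1
            fourier_support := fun i => (hψ i).2.2.1
            norm_eq_one := fun i => (hψ i).2.2.2 }⟩
  · rw [mem_ball] at hξ
    have h1 : ‖ξ‖ ≤ ‖ξc i‖ + dist ξ (ξc i) := norm_le_norm_add_const_of_dist_le le_rfl
    have h2 : ‖ξc i‖ - ‖ξ‖ ≤ dist ξ (ξc i) := by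
      rw [dist_comm, dist_eq_norm]
      exact norm_sub_norm_le _ _
    rw [hnorm] at h1 h2
    constructor
    · linarith
    · linarith
  · rw [neg_ball]
    exact ball_disjoint_ball (hr3 i j).le

end Literature.Analysis.FluidPDE.Tao2016
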